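import Summits.KontsevichZagierPeriods.KontsevichZagierPeriods.Theorems.HurwitzMicroSectorsNormalFormPrincipleM4RelDilations4
import Summits.KontsevichZagierPeriods.KontsevichZagierPeriods.Theorems.HurwitzMicroSectorsNormalFormPrincipleM4RelPdil4
import Summits.KontsevichZagierPeriods.KontsevichZagierPeriods.Theorems.HurwitzMicroSectorsNormalFormPrincipleM4RelShuffles4
import Summits.KontsevichZagierPeriods.KontsevichZagierPeriods.Theorems.HurwitzMicroSectorsNormalFormPrincipleM4RelBstuffle13p
import Summits.KontsevichZagierPeriods.KontsevichZagierPeriods.Theorems.HurwitzMicroSectorsNormalFormPrincipleM4RelBstuffle13m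
import Summits.KontsevichZagierPeriods.KontsevichZagierPeriods.Theorems.HurwitzMicroSectorsNormalFormPrincipleM4RelBstuffle22pm
import Summits.KontsevichZagierPeriods.KontsevichZagierPeriods.Theorems.HurwitzMicroSectorsNormalFormPrincipleM4RelBstuffle22pp
import Summits.KontsevichZagierPeriods.KontsevichZagierPeriods.Theorems.MzvKernelInKZ.Negative.ScalingDivision

/-!
# `NormalFormPrinciple` (stmt-KontsevichZagierPeriods-3869), line `SketchIdeator1` —
# leaf `stub_boxRigidity`, layer `M4`: the weight-four MZV relations FROM LEVEL TWO

Pure proof file (lead seat c9; `--supports` the crux). A by-product of the dimension-four stuffle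
campaign: the thirteen landed level-two relations of the calculus (three dilations = DISTRIBUTION
relations `t ↦ t²`, four shuffles, two partial dilations in the product ideal, four stuffles as
partial fractions of product boxes) already contain, as INTEGER combinations, the classical
weight-four relations among LEVEL-ONE iterated integrals — read as Kontsevich–Zagier relations among
word representations on `Δ₄` (`a = dt/t`, `b = dt/(1−t)`) and products of lower words:

* `4[aabb] − [aaab] ∈ KZ.relations`            (`ζ(3,1) = ζ(4)/4`, Euler–Borwein),
* `4[abab] − 3[aaab] ∈ KZ.relations`           (`ζ(2,2) = (3/4)ζ(4)`),
* `2[ab]·[ab] − 5[aaab]`, `4[ab]·[ac] − 5[aaab]`, `8[ac]·[ac] − 5[aaab] ∈ KZ.relations`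
  (`ζ(2)² = (5/2)ζ(4)`, and its alternating companions `[ac] = [ab]/2`).

So in weight four the distribution relations of level two REPLACE the regularised double shuffle of
level one (compare the level-one derivation `MzvKernelInKZ…EdsCertificateLow` of the tree): e.g.
`3·(4[aabb] − [aaab]) = 8·bst22pm − 4·bst22pp + 2·dil_abab + dil_aaab − 3·sh_ab_ab − 3·pdil_ab_ab + 2·pdil_ab_ac`
(exact certificates `tmp/w4/kernel4_check.py` of the seat; the factor `3` is divided out by the
scaling move). Carriers are hypotheses. Corollaries as box instances of the leaf:
`…M4LevelOneFromLevelTwo.lean`.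
References: M. Kontsevich, D. Zagier, *Periods* (2001), §1.2; D. Borwein, J. Borwein, R. Girgensohn,
Proc. Edinburgh Math. Soc. 38 (1995) (`ζ(3,1) = ζ(4)/4`); D. J. Broadhurst, arXiv:hep-th/9604128
(alternating sums and MZV relations). No definitions are introduced.
-/

noncomputable section

open MeasureTheory Set
open Literature.NumberTheory.Transcendental Literature.NumberTheory.Transcendental.KZ

namespace Summit.KontsevichZagierPeriods.HurwitzMicroSectors.NormalFormPrinciple.PiBox.M3

/-- **The weight-four MZV relations from level two** (lead seat c9, line `SketchIdeator1`, layer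
`M4`). For arbitrary carriers of the interval `[(0,1), dt/(1+t)]`, the words `ab, ac` on `Δ₂`,
`aab, aac` on `Δ₃` and twelve words on `Δ₄`: `4[aabb] − [aaab]`, `4[abab] − 3[aaab]`,
`2[ab]·[ab] − 5[aaab]`, `4[ab]·[ac] − 5[aaab]`, `8[ac]·[ac] − 5[aaab]` lie in `KZ.relations`
(integer combinations of the thirteen landed level-two relations; `ζ(3,1) = ζ(4)/4`,
`ζ(2,2) = 3ζ(4)/4`, `ζ(2)² = 5ζ(4)/2`). [cite: KontsevichZagier2001, §1.2 rules (1), (2); §4.1] -/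
theorem m4_weightFour_mzv_levelTwo :
    ∀ (C1 : IntegralRep 1), C1.domain = {x | ∀ i, x i ∈ Set.Ioo (0:ℝ) 1} → (C1.integrand = fun x => 1 / (1 + x 0)) →
      ∀ (AB : IntegralRep 2), AB.domain = {t | 0 < t 1 ∧ t 1 < t 0 ∧ t 0 < 1} → (AB.integrand = fun t => 1 / t 0 * (1 / (1 - t 1))) →
      ∀ (AC : IntegralRep 2), AC.domain = {t | 0 < t 1 ∧ t 1 < t 0 ∧ t 0 < 1} → (AC.integrand = fun t => 1 / t 0 * (1 / (1 + t 1))) →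
      ∀ (AAB : IntegralRep 3), AAB.domain = {t | 0 < t 2 ∧ t 2 < t 1 ∧ t 1 < t 0 ∧ t 0 < 1} → (AAB.integrand = fun t => 1 / t 0 * 1 / t 1 * (1 / (1 - t 2))) →
      ∀ (AAC : IntegralRep 3), AAC.domain = {t | 0 < t 2 ∧ t 2 < t 1 ∧ t 1 < t 0 ∧ t 0 < 1} → (AAC.integrand = fun t => 1 / t 0 * 1 / t 1 * (1 / (1 + t 2))) →
      ∀ (AAAB : IntegralRep 4), AAAB.domain = {t | 0 < t 3 ∧ t 3 < t 2 ∧ t 2 < t 1 ∧ t 1 < t 0 ∧ t 0 < 1} → (AAAB.integrand = fun t => 1 / t 0 * (1 / t 1) * (1 / t 2) * (1 / (1 - t 3))) →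
      ∀ (AAAC : IntegralRep 4), AAAC.domain = {t | 0 < t 3 ∧ t 3 < t 2 ∧ t 2 < t 1 ∧ t 1 < t 0 ∧ t 0 < 1} → (AAAC.integrand = fun t => 1 / t 0 * (1 / t 1) * (1 / t 2) * (1 / (1 + t 3))) →
      ∀ (AABB : IntegralRep 4), AABB.domain = {t | 0 < t 3 ∧ t 3 < t 2 ∧ t 2 < t 1 ∧ t 1 < t 0 ∧ t 0 < 1} → (AABB.integrand = fun t => 1 / t 0 * (1 / t 1) * (1 / (1 - t 2)) * (1 / (1 - t 3))) →
      ∀ (AABC : IntegralRep 4), AABC.domain = {t | 0 < t 3 ∧ t 3 < t 2 ∧ t 2 < t 1 ∧ t 1 < t 0 ∧ t 0 < 1} → (AABC.integrand = fun t => 1 / t 0 * (1 / t 1) * (1 / (1 - t 2)) * (1 / (1 + t 3))) →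
      ∀ (AACB : IntegralRep 4), AACB.domain = {t | 0 < t 3 ∧ t 3 < t 2 ∧ t 2 < t 1 ∧ t 1 < t 0 ∧ t 0 < 1} → (AACB.integrand = fun t => 1 / t 0 * (1 / t 1) * (1 / (1 + t 2)) * (1 / (1 - t 3))) →
      ∀ (AACC : IntegralRep 4), AACC.domain = {t | 0 < t 3 ∧ t 3 < t 2 ∧ t 2 < t 1 ∧ t 1 < t 0 ∧ t 0 < 1} → (AACC.integrand = fun t => 1 / t 0 * (1 / t 1) * (1 / (1 + t 2)) * (1 / (1 + t 3))) →
      ∀ (ABAB : IntegralRep 4), ABAB.domain = {t | 0 < t 3 ∧ t 3 < t 2 ∧ t 2 < t 1 ∧ t 1 < t 0 ∧ t 0 < 1} → (ABAB.integrand = fun t => 1 / t 0 * (1 / (1 - t 1)) * (1 / t 2) * (1 / (1 - t 3))) →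
      ∀ (ABAC : IntegralRep 4), ABAC.domain = {t | 0 < t 3 ∧ t 3 < t 2 ∧ t 2 < t 1 ∧ t 1 < t 0 ∧ t 0 < 1} → (ABAC.integrand = fun t => 1 / t 0 * (1 / (1 - t 1)) * (1 / t 2) * (1 / (1 + t 3))) →
      ∀ (ACAB : IntegralRep 4), ACAB.domain = {t | 0 < t 3 ∧ t 3 < t 2 ∧ t 2 < t 1 ∧ t 1 < t 0 ∧ t 0 < 1} → (ACAB.integrand = fun t => 1 / t 0 * (1 / (1 + t 1)) * (1 / t 2) * (1 / (1 - t 3))) →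
      ∀ (ACAC : IntegralRep 4), ACAC.domain = {t | 0 < t 3 ∧ t 3 < t 2 ∧ t 2 < t 1 ∧ t 1 < t 0 ∧ t 0 < 1} → (ACAC.integrand = fun t => 1 / t 0 * (1 / (1 + t 1)) * (1 / t 2) * (1 / (1 + t 3))) →
      ∀ (CAAB : IntegralRep 4), CAAB.domain = {t | 0 < t 3 ∧ t 3 < t 2 ∧ t 2 < t 1 ∧ t 1 < t 0 ∧ t 0 < 1} → (CAAB.integrand = fun t => 1 / (1 + t 0) * (1 / t 1) * (1 / t 2) * (1 / (1 - t 3))) →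
      ∀ (CAAC : IntegralRep 4), CAAC.domain = {t | 0 < t 3 ∧ t 3 < t 2 ∧ t 2 < t 1 ∧ t 1 < t 0 ∧ t 0 < 1} → (CAAC.integrand = fun t => 1 / (1 + t 0) * (1 / t 1) * (1 / t 2) * (1 / (1 + t 3))) →
      ((4:ℤ) • of AABB - of AAAB ∈ relations) ∧
      ((4:ℤ) • of ABAB - (3:ℤ) • of AAAB ∈ relations) ∧
      ((2:ℤ) • of (AB.prod AB) - (5:ℤ) • of AAAB ∈ relations) ∧
      ((4:ℤ) • of (AB.prod AC) - (5:ℤ) • of AAAB ∈ relations) ∧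
      ((8:ℤ) • of (AC.prod AC) - (5:ℤ) • of AAAB ∈ relations) := by
  intro C1 hC1d hC1i AB hABd hABi AC hACd hACi AAB hAABd hAABi AAC hAACd hAACi AAAB hAAABd hAAABi AAAC hAAACd hAAACi AABB hAABBd hAABBi AABC hAABCd hAABCi AACB hAACBd hAACBi AACC hAACCd hAACCi ABAB hABABd hABABi ABAC hABACd hABACi ACAB hACABd hACABi ACAC hACACd hACACi CAAB hCAABd hCAABi CAAC hCAACd hCAACi

  obtain ⟨d1, d2, d3⟩ := m4_rel_dilations4 AAAB hAAABd hAAABi AAAC hAAACd hAAACi AABB hAABBd hAABBi AABC hAABCd hAABCi AACB hAACBd hAACBi AACC hAACCd hAACCi ABAB hABABd hABABi ABAC hABACd hABACi ACAB hACABd hACABi ACAC hACACd hACACi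
  obtain ⟨s1, s2, s3, s4⟩ := m4_rel_shuffles4 C1 hC1d hC1i AB hABd hABi AC hACd hACi AAB hAABd hAABi
    AAC hAACd hAACi AABB hAABBd hAABBi ABAB hABABd hABABi AABC hAABCd hAABCi AACB hAACBd hAACBi ABAC hABACd hABACi ACAB hACABd hACABi CAAB hCAABd hCAABi AACC hAACCd hAACCi ACAC hACACd hACACi CAAC hCAACd hCAACi
  obtain ⟨p1, p2⟩ := m4_rel_pdil4 AB hABd hABi AC hACd hACi
  have b1 := m4_rel_bstuffle13p C1 hC1d hC1i AAC hAACd hAACi AAAB hAAABd hAAABi AACB hAACBd hAACBi CAAB hCAABd hCAABi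
  have b2 := m4_rel_bstuffle13m C1 hC1d hC1i AAB hAABd hAABi AAAC hAAACd hAAACi AABC hAABCd hAABCi CAAC hCAACd hCAACi
  have b3 := m4_rel_bstuffle22pm AB hABd hABi AC hACd hACi AAAC hAAACd hAAACi ABAC hABACd hABACi ACAC hACACd hACACi
  have b4 := m4_rel_bstuffle22pp AC hACd hACi AAAB hAAABd hAAABi ACAB hACABd hACABi
  refine ⟨?_, ?_, ?_, ?_, ?_⟩
  · refine Summit.KontsevichZagierPeriods.MzvKernelInKZ.Negative.mem_relations_of_nsmul_mem
      (by norm_num : 0 < 3) ?_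
    have e : (3:ℕ) • ((4:ℤ) • of AABB - of AAAB) =
        (8:ℤ) • (of (AB.prod AC) - of AAAC - of ABAC + of ACAC) +
        (-4:ℤ) • (of (AC.prod AC) - of AAAB + (2:ℤ) • of ACAB) +
        (2:ℤ) • ((4:ℤ) • of ABAC + (4:ℤ) • of ACAB - (4:ℤ) • of ACAC - (3:ℤ) • of ABAB) +
        (1:ℤ) • ((8:ℤ) • of AAAC - (7:ℤ) • of AAAB) +
        (-3:ℤ) • (of (AB.prod AB) - (4:ℤ) • of AABB - (2:ℤ) • of ABAB) +
        (-3:ℤ) • ((2:ℤ) • of (AB.prod AC) - of (AB.prod AB)) +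
        (2:ℤ) • ((2:ℤ) • of (AC.prod AC) - of (AB.prod AC)) := by
      simp only [smul_sub, smul_add, smul_smul]
      norm_num
      abel
    rw [e]
    exact (relations.add_mem (relations.add_mem (relations.add_mem (relations.add_mem (relations.add_mem (relations.add_mem (relations.zsmul_mem b3 _) (relations.zsmul_mem b4 _)) (relations.zsmul_mem d3 _)) (relations.zsmul_mem d1 _)) (relations.zsmul_mem s4 _)) (relations.zsmul_mem p1 _)) (relations.zsmul_mem p2 _))
  · refine Summit.KontsevichZagierPeriods.MzvKernelInKZ.Negative.mem_relations_of_nsmul_mem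
      (by norm_num : 0 < 3) ?_
    have e : (3:ℕ) • ((4:ℤ) • of ABAB - (3:ℤ) • of AAAB) =
        (24:ℤ) • (of (C1.prod AAC) - of AAAB + of AACB + of CAAB) +
        (-24:ℤ) • (of (C1.prod AAB) - of AAAC - of AABC + of CAAC) +
        (-16:ℤ) • (of (AB.prod AC) - of AAAC - of ABAC + of ACAC) +
        (20:ℤ) • (of (AC.prod AC) - of AAAB + (2:ℤ) • of ACAB) +
        (12:ℤ) • ((4:ℤ) • of AABC + (4:ℤ) • of AACB - (4:ℤ) • of AACC - (3:ℤ) • of AABB) +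
        (2:ℤ) • ((4:ℤ) • of ABAC + (4:ℤ) • of ACAB - (4:ℤ) • of ACAC - (3:ℤ) • of ABAB) +
        (24:ℤ) • (of (AB.prod AC) - (2:ℤ) • of AABC - (2:ℤ) • of AACB - of ABAC - of ACAB) +
        (24:ℤ) • (of (C1.prod AAB) - of AABC - of AACB - of ACAB - of CAAB) +
        (-5:ℤ) • ((8:ℤ) • of AAAC - (7:ℤ) • of AAAB) +
        (-24:ℤ) • (of (C1.prod AAC) - (2:ℤ) • of AACC - of ACAC - of CAAC) +
        (-9:ℤ) • (of (AB.prod AB) - (4:ℤ) • of AABB - (2:ℤ) • of ABAB) +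
        (-9:ℤ) • ((2:ℤ) • of (AB.prod AC) - of (AB.prod AB)) +
        (-10:ℤ) • ((2:ℤ) • of (AC.prod AC) - of (AB.prod AC)) := by
      simp only [smul_sub, smul_add, smul_smul]
      norm_num
      abel
    rw [e]
    exact (relations.add_mem (relations.add_mem (relations.add_mem (relations.add_mem (relations.add_mem (relations.add_mem (relations.add_mem (relations.add_mem (relations.add_mem (relations.add_mem (relations.add_mem (relations.add_mem (relations.zsmul_mem b1 _) (relations.zsmul_mem b2 _)) (relations.zsmul_mem b3 _)) (relations.zsmul_mem b4 _)) (relations.zsmul_mem d2 _)) (relations.zsmul_mem d3 _)) (relations.zsmul_mem s1 _)) (relations.zsmul_mem s2 _)) (relations.zsmul_mem d1 _)) (relations.zsmul_mem s3 _)) (relations.zsmul_mem s4 _)) (relations.zsmul_mem p1 _)) (relations.zsmul_mem p2 _))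
  · have e : (2:ℤ) • of (AB.prod AB) - (5:ℤ) • of AAAB =
        (8:ℤ) • (of (C1.prod AAC) - of AAAB + of AACB + of CAAB) +
        (-8:ℤ) • (of (C1.prod AAB) - of AAAC - of AABC + of CAAC) +
        (4:ℤ) • (of (AC.prod AC) - of AAAB + (2:ℤ) • of ACAB) +
        (4:ℤ) • ((4:ℤ) • of AABC + (4:ℤ) • of AACB - (4:ℤ) • of AACC - (3:ℤ) • of AABB) +
        (2:ℤ) • ((4:ℤ) • of ABAC + (4:ℤ) • of ACAB - (4:ℤ) • of ACAC - (3:ℤ) • of ABAB) +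
        (8:ℤ) • (of (AB.prod AC) - (2:ℤ) • of AABC - (2:ℤ) • of AACB - of ABAC - of ACAB) +
        (8:ℤ) • (of (C1.prod AAB) - of AABC - of AACB - of ACAB - of CAAB) +
        (-1:ℤ) • ((8:ℤ) • of AAAC - (7:ℤ) • of AAAB) +
        (-8:ℤ) • (of (C1.prod AAC) - (2:ℤ) • of AACC - of ACAC - of CAAC) +
        (-3:ℤ) • (of (AB.prod AB) - (4:ℤ) • of AABB - (2:ℤ) • of ABAB) +
        (-5:ℤ) • ((2:ℤ) • of (AB.prod AC) - of (AB.prod AB)) +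
        (-2:ℤ) • ((2:ℤ) • of (AC.prod AC) - of (AB.prod AC)) := by
      simp only [smul_sub, smul_add, smul_smul]
      norm_num
      abel
    rw [e]
    exact (relations.add_mem (relations.add_mem (relations.add_mem (relations.add_mem (relations.add_mem (relations.add_mem (relations.add_mem (relations.add_mem (relations.add_mem (relations.add_mem (relations.add_mem (relations.zsmul_mem b1 _) (relations.zsmul_mem b2 _)) (relations.zsmul_mem b4 _)) (relations.zsmul_mem d2 _)) (relations.zsmul_mem d3 _)) (relations.zsmul_mem s1 _)) (relations.zsmul_mem s2 _)) (relations.zsmul_mem d1 _)) (relations.zsmul_mem s3 _)) (relations.zsmul_mem s4 _)) (relations.zsmul_mem p1 _)) (relations.zsmul_mem p2 _))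
  · have e : (4:ℤ) • of (AB.prod AC) - (5:ℤ) • of AAAB =
        (8:ℤ) • (of (C1.prod AAC) - of AAAB + of AACB + of CAAB) +
        (-8:ℤ) • (of (C1.prod AAB) - of AAAC - of AABC + of CAAC) +
        (4:ℤ) • (of (AC.prod AC) - of AAAB + (2:ℤ) • of ACAB) +
        (4:ℤ) • ((4:ℤ) • of AABC + (4:ℤ) • of AACB - (4:ℤ) • of AACC - (3:ℤ) • of AABB) +
        (2:ℤ) • ((4:ℤ) • of ABAC + (4:ℤ) • of ACAB - (4:ℤ) • of ACAC - (3:ℤ) • of ABAB) +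
        (8:ℤ) • (of (AB.prod AC) - (2:ℤ) • of AABC - (2:ℤ) • of AACB - of ABAC - of ACAB) +
        (8:ℤ) • (of (C1.prod AAB) - of AABC - of AACB - of ACAB - of CAAB) +
        (-1:ℤ) • ((8:ℤ) • of AAAC - (7:ℤ) • of AAAB) +
        (-8:ℤ) • (of (C1.prod AAC) - (2:ℤ) • of AACC - of ACAC - of CAAC) +
        (-3:ℤ) • (of (AB.prod AB) - (4:ℤ) • of AABB - (2:ℤ) • of ABAB) +
        (-3:ℤ) • ((2:ℤ) • of (AB.prod AC) - of (AB.prod AB)) +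
        (-2:ℤ) • ((2:ℤ) • of (AC.prod AC) - of (AB.prod AC)) := by
      simp only [smul_sub, smul_add, smul_smul]
      norm_num
      abel
    rw [e]
    exact (relations.add_mem (relations.add_mem (relations.add_mem (relations.add_mem (relations.add_mem (relations.add_mem (relations.add_mem (relations.add_mem (relations.add_mem (relations.add_mem (relations.add_mem (relations.zsmul_mem b1 _) (relations.zsmul_mem b2 _)) (relations.zsmul_mem b4 _)) (relations.zsmul_mem d2 _)) (relations.zsmul_mem d3 _)) (relations.zsmul_mem s1 _)) (relations.zsmul_mem s2 _)) (relations.zsmul_mem d1 _)) (relations.zsmul_mem s3 _)) (relations.zsmul_mem s4 _)) (relations.zsmul_mem p1 _)) (relations.zsmul_mem p2 _))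
  · have e : (8:ℤ) • of (AC.prod AC) - (5:ℤ) • of AAAB =
        (8:ℤ) • (of (C1.prod AAC) - of AAAB + of AACB + of CAAB) +
        (-8:ℤ) • (of (C1.prod AAB) - of AAAC - of AABC + of CAAC) +
        (4:ℤ) • (of (AC.prod AC) - of AAAB + (2:ℤ) • of ACAB) +
        (4:ℤ) • ((4:ℤ) • of AABC + (4:ℤ) • of AACB - (4:ℤ) • of AACC - (3:ℤ) • of AABB) +
        (2:ℤ) • ((4:ℤ) • of ABAC + (4:ℤ) • of ACAB - (4:ℤ) • of ACAC - (3:ℤ) • of ABAB) +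
        (8:ℤ) • (of (AB.prod AC) - (2:ℤ) • of AABC - (2:ℤ) • of AACB - of ABAC - of ACAB) +
        (8:ℤ) • (of (C1.prod AAB) - of AABC - of AACB - of ACAB - of CAAB) +
        (-1:ℤ) • ((8:ℤ) • of AAAC - (7:ℤ) • of AAAB) +
        (-8:ℤ) • (of (C1.prod AAC) - (2:ℤ) • of AACC - of ACAC - of CAAC) +
        (-3:ℤ) • (of (AB.prod AB) - (4:ℤ) • of AABB - (2:ℤ) • of ABAB) +
        (-3:ℤ) • ((2:ℤ) • of (AB.prod AC) - of (AB.prod AB)) +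
        (2:ℤ) • ((2:ℤ) • of (AC.prod AC) - of (AB.prod AC)) := by
      simp only [smul_sub, smul_add, smul_smul]
      norm_num
      abel
    rw [e]
    exact (relations.add_mem (relations.add_mem (relations.add_mem (relations.add_mem (relations.add_mem (relations.add_mem (relations.add_mem (relations.add_mem (relations.add_mem (relations.add_mem (relations.add_mem (relations.zsmul_mem b1 _) (relations.zsmul_mem b2 _)) (relations.zsmul_mem b4 _)) (relations.zsmul_mem d2 _)) (relations.zsmul_mem d3 _)) (relations.zsmul_mem s1 _)) (relations.zsmul_mem s2 _)) (relations.zsmul_mem d1 _)) (relations.zsmul_mem s3 _)) (relations.zsmul_mem s4 _)) (relations.zsmul_mem p1 _)) (relations.zsmul_mem p2 _))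

end Summit.KontsevichZagierPeriods.HurwitzMicroSectors.NormalFormPrinciple.PiBox.M3
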